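import Literature.AnabelianGeometry.EtaleTheta.Discharge.Sec5Thm57KummerComparisonOfPin
import Literature.AnabelianGeometry.EtaleTheta.Discharge.Sec5Prop52iiiRootKummerOfBiKummerData

/-!
# [EtTh] §5, Theorem 5.7: the Kummer comparison `HC` from Prop. 5.2 (iii) (LANDED pin), Thm. 5.6 and Cor. 2.8 (i) read on the ÉTALE side (pp. 324–331 / PDF pp. 98–105)

Mochizuki, *The étale theta function …*, Publ. RIMS **45** (2009)
[cite: MochizukiEtTh2009, Thm 5.7 proof p.330 (PDF p.104); Prop 5.2 (iii) p.324 (PDF p.98); Thm 5.6 p.328 (PDF p.102); Cor 2.8 (i)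
p.268 (PDF p.42); Lem 5.9 (iv) p.332 (PDF p.106)].  Seat abc-iut-L2-d4 (gen 5; node `EtTh:Thm5.7`, L2-lead R381/R408 «(C)-junction
composer»).  PROOF-ONLY over my `Sec5Thm57KummerComparisonOfPin.lean` (p449260) and abc-iut-L2-t4's R-C3 file
`Sec5Prop52iiiRootKummerOfBiKummerData.lean` (p-R-C3, `sgpCap_mul_sgpCup_inv_eq_of_thetaSectionCompat`) — its FIRST consumer.

THE POINT.  p449260 assembled `HC` (the one anabelian input of `isFixed_discrepancy_of_kummerComparison`, p448195) from three
statements about an ARBITRARY `ρ : M → Aut_C(B_N)`.  Here `M` is instantiated ON THE ÉTALE SIDE, in the vocabulary the §5 ↔ §2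
dictionary of the tree already has (abc-iut-L2-t2's `ThetaEnvData` `T`, abc-iut-L2-t11's `ThetaSectionCompat`, abc-iut-L2-t4's pin):
`M := T.mu` (the cyclotome `Δ_{μ_N} ≅ (l·Δ_Θ) ⊗ ℤ/N` of the mono-theta data), `ρ := m⁻¹ : μ_N → μ_N(B_N) ⊆ Aut_C(B_N)` (the
identification `m` — Prop. 5.5's when so instantiated), `η̃ :=` the mod-`N` étale theta cocycle `η : Π^tp_Ÿ → μ_N` read on `H_{B_N}`
through `ι : Π^tp_X̲ ⥲ Π^tp_X`.  In this currency print's sentence (proof of Thm. 5.7, p.330) splits into FIVE named inputs, each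
owned by one seat of the cell:
* (pin)     `ThetaSectionCompat H T ι m hι η` — Prop. 5.2 (iii) [abc-iut-L2-t4 R-C3, LANDED: `thetaSectionCompat_iff_rootKummer_…`
            reduces it at the genuine data to a clause on the root function; the junction «`θ := Θ̈`» is abc-iut-f-125's];
* (K4m)     `Ψ^Aut_β(m⁻¹ x) = m⁻¹(γ_Δ x)` — Thm. 5.6: `Ψ` preserves the identification `m`, acting on the étale cyclotome by `γ_Δ`
            [K4, abc-iut-w5-d034 / w5-d020];
* (C5ét)    `γ_Δ(η k) = η(γ k) · κ(γ k)` on `Π^tp_Ÿ` — Cor. 2.8 (i): the class `η̈^Θ mod N` is carried to itself by the Galois shadow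
            `γ` of `Ψ` up to a cocycle `κ` (coboundary · Kummer cocycle of the `(l·ℤ × μ₂)`/`O_K^×`-indeterminacy) [R-C5, abc-iut-w6-d083];
* (κreal)   `m⁻¹(κ(ι k)) = s^⊔-gp_N(ρ k)·ξ·s^⊔-gp_N(ρ k)⁻¹·ξ⁻¹` — the cocycle `κ` IS the Kummer cocycle on `H_{B_N}` of a unit
            `ξ ∈ O^×(B_N)` (for a coboundary `κ = ∂c`: Lemma 5.8's cyclotomic character law with `ξ := m⁻¹ c`) [R-C5's Frobenioid half];
* (shadow)  `θ(ρ k) = ρ(ι⁻¹ γ ι k)` — `θ = (Ψ^bs)^Aut` on `Aut_D(B_N^bs)` IS induced by `γ` [the quasi-temperoid step, Thm. 5.6's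
            `D`-side; abc-iut-w5-d245's `hstrv`-currency].
`ThetaFrobenioid.kummerComparison_of_thetaSectionCompat` : (pin) + (K4m) + (C5ét) + (κreal) + (shadow) ⇒ `HC` VERBATIM as consumed
by p448195; with p448195 → p445839 → p445072 → p446712/p448709 this is the complete (C)-chain of Thm. 5.7 modulo the four étale-side
inputs.  Also: `eta_apply_eq_of_rho_eq` — under (pin) the cocycle `η ∘ ι` is CONSTANT on the fibres of `ρ : Π^tp_Ÿ̲ ↠ H_{B_N}`
(it factors through `H_{B_N}`, as print's «twisted homomorphism `H_{B_N} → μ_N(B_N)`», Prop. 4.3 (iii) p.317, requires), and the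
`H_{B_N}`-indexed pin `sgpCap_mul_sgpCup_inv_eq_of_thetaSectionCompat_of_section` for any set-theoretic section of `ρ`.
ORIENTATIONS are conventions of this interface (a producer with `κ` on the other side passes `κ⁻¹`); `ξ` is ANY element of `Aut_C(B_N)`
here (p448195 asks `ξ ∈ O^×(B_N)`), so non-torsion Kummer multipliers (the `l·ℤ`-translation indeterminacy of Thm. 5.7) are NOT excluded.
HONEST FRAMING: kernel-checked bookkeeping; none of the five inputs is proved here; nothing of [EtTh] is asserted unconditionally;
typed ≠ discharged; no side taken on anything downstream ([IUTchIII] Cor. 3.12 in particular). -/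

namespace Literature.AnabelianGeometry.EtaleTheta

open CategoryTheory

universe w v v' u u'

namespace ThetaFrobenioid

variable {C : Type u} [Category.{v} C] {D : Type u'} [Category.{v'} D] {𝔉 : ThetaFrobenioid.{w} C D}

/-- **Under the pin, `η ∘ ι` factors through `H_{B_N}`**: if `ThetaSectionCompat H T ι m hι η` (Prop. 5.2 (iii): the bi-Kummer
difference cocycle is `m⁻¹ ∘ η⁻¹ ∘ ι` on `Π^tp_Ÿ̲`), then `η(ι k)` depends only on `ρ k ∈ H_{B_N}` — print's «twisted homomorphism
`H_{B_N} → μ_N(B_N)`» (Prop. 4.3 (iii) p.317 (PDF p.91)).  [cite: MochizukiEtTh2009, Prop 4.3 (iii) p.317 (PDF p.91); Prop 5.2 (iii) p.324 (PDF p.98)] -/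
theorem eta_apply_eq_of_rho_eq (H : 𝔉.Facts) (T : ThetaEnvData.{v} 𝔉.N) (ι : 𝔉.PiX ≃* T.PiX)
    (m : 𝔉.muTorsion 𝔉.BN 𝔉.N ≃* T.mu) (hι : 𝔉.IdentifiesPiYdd T ι) {η : T.PiYdd → T.mu}
    (hpin : 𝔉.ThetaSectionCompat H T ι m hι η) {k k' : 𝔉.PiYdd} (e : 𝔉.ρ k = 𝔉.ρ k') :
    η ⟨ι k, (hι k).mp k.2⟩ = η ⟨ι k', (hι k').mp k'.2⟩ := by
  have er : 𝔉.rhoYdd k = 𝔉.rhoYdd k' := Subtype.ext e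
  have hd : 𝔉.diffCocycle H k = 𝔉.diffCocycle H k' := by
    change (fun x : 𝔉.HB => (⟨𝔉.sgpCup x * (𝔉.sgpCap (x : Aut (𝔉.base.obj 𝔉.BN)))⁻¹,
        H.biKummerDifferenceMem x⟩ : 𝔉.muTorsion 𝔉.BN 𝔉.N)) (𝔉.rhoYdd k) =
      (fun x : 𝔉.HB => (⟨𝔉.sgpCup x * (𝔉.sgpCap (x : Aut (𝔉.base.obj 𝔉.BN)))⁻¹,
        H.biKummerDifferenceMem x⟩ : 𝔉.muTorsion 𝔉.BN 𝔉.N)) (𝔉.rhoYdd k')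
    rw [er]
  have hk := hpin k
  have hk' := hpin k'
  rw [hd, hk'] at hk
  exact inv_injective hk.symm

/-- **The pin read on `H_{B_N}`** (Prop. 5.2 (iii) in the shape of p449260's `hpin`): for ANY set-theoretic section `pre` of
`ρ : Π^tp_Ÿ̲ ↠ H_{B_N}`, `s^⊓-gp_N(h)·s^⊔-gp_N(h)⁻¹ = m⁻¹(η(ι(pre h)))` for every `h ∈ H_{B_N}` — abc-iut-L2-t4's
`sgpCap_mul_sgpCup_inv_eq_of_thetaSectionCompat` re-indexed.  [cite: MochizukiEtTh2009, Prop 5.2 (iii) p.324 (PDF p.98); §5 p.331 (PDF p.105)] -/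
theorem sgpCap_mul_sgpCup_inv_eq_of_thetaSectionCompat_of_section (H : 𝔉.Facts) (T : ThetaEnvData.{v} 𝔉.N)
    (ι : 𝔉.PiX ≃* T.PiX) (m : 𝔉.muTorsion 𝔉.BN 𝔉.N ≃* T.mu) (hι : 𝔉.IdentifiesPiYdd T ι) {η : T.PiYdd → T.mu}
    (hpin : 𝔉.ThetaSectionCompat H T ι m hι η) (pre : 𝔉.HB → 𝔉.PiYdd)
    (hpre : ∀ h : 𝔉.HB, 𝔉.ρ (pre h) = h) (h : 𝔉.HB) :
    𝔉.sgpCap (h : Aut (𝔉.base.obj 𝔉.BN)) * (𝔉.sgpCup h)⁻¹ =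
      ((m.symm (η ⟨ι (pre h), (hι (pre h)).mp (pre h).2⟩) : 𝔉.muTorsion 𝔉.BN 𝔉.N) : Aut 𝔉.BN) := by
  have e : 𝔉.rhoYdd (pre h) = h := Subtype.ext (hpre h)
  have key := 𝔉.sgpCap_mul_sgpCup_inv_eq_of_thetaSectionCompat H T ι m hι hpin (pre h)
  rw [← key]
  exact congrArg (fun x : 𝔉.HB => 𝔉.sgpCap (x : Aut (𝔉.base.obj 𝔉.BN)) * (𝔉.sgpCup x)⁻¹) e.symm

/-- **`HC` from the pin, Thm. 5.6 and Cor. 2.8 (i) on the étale side** — see the module docstring for the five inputs (pin),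
(K4m), (C5ét), (κreal), (shadow).  Conclusion: VERBATIM the hypothesis `HC` of `isFixed_discrepancy_of_kummerComparison` (p448195),
i.e. `Ψ^Aut_β(s^⊓-gp_N(h)·s^⊔-gp_N(h)⁻¹) = (s^⊓-gp_N(θh)·s^⊔-gp_N(θh)⁻¹)·(s^⊔-gp_N(θh)·ξ·s^⊔-gp_N(θh)⁻¹·ξ⁻¹)` for all
`h ∈ H_{B_N}` — print: «by applying the rigidity of the étale theta function [Cor. 2.8 (i)] to the Kummer classes of Prop. 5.2 (iii)
… in light of the crucial isomorphisms of Prop. 5.5, which, by Thm. 5.6, are preserved by `Ψ`» (proof of Thm. 5.7, p.330 (PDF p.104)).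
Obtained from p449260's `kummerComparison_of_pin` with `M := T.mu`, `ρ := m⁻¹`, `η̃ := η ∘ ι ∘ pre` (`pre` a section of `ρ`, by
choice), using `eta_apply_eq_of_rho_eq` to move between `ρ`-fibre representatives.
[cite: MochizukiEtTh2009, Thm 5.7 proof p.330 (PDF p.104); Thm 5.6 p.328 (PDF p.102); Cor 2.8 (i) p.268 (PDF p.42); Prop 5.2 (iii) p.324 (PDF p.98)] -/
theorem kummerComparison_of_thetaSectionCompat (H : 𝔉.Facts) (T : ThetaEnvData.{v} 𝔉.N) (ι : 𝔉.PiX ≃* T.PiX)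
    (m : 𝔉.muTorsion 𝔉.BN 𝔉.N ≃* T.mu) (hι : 𝔉.IdentifiesPiYdd T ι) {η : T.PiYdd → T.mu}
    (hpin : 𝔉.ThetaSectionCompat H T ι m hι η)
    (Ψ : C ≌ C) (β : Ψ.functor.obj 𝔉.BN ≅ 𝔉.BN)
    (θ : Aut (𝔉.base.obj 𝔉.BN) ≃* Aut (𝔉.base.obj 𝔉.BN)) (hYdd : 𝔉.HB.map θ.toMonoidHom = 𝔉.HB) (ξ : Aut 𝔉.BN)
    (γ : T.PiX → T.PiX) (hγ : ∀ x : T.PiX, x ∈ T.PiYdd → γ x ∈ T.PiYdd) (γΔ : T.mu → T.mu) (κ : T.PiYdd → T.mu)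
    (hshadow : ∀ k : 𝔉.PiYdd, θ (𝔉.ρ k) = 𝔉.ρ (ι.symm (γ (ι k))))
    (hK4 : ∀ x : T.mu, 𝔉.psiAut Ψ β ((m.symm x : 𝔉.muTorsion 𝔉.BN 𝔉.N) : Aut 𝔉.BN) =
      ((m.symm (γΔ x) : 𝔉.muTorsion 𝔉.BN 𝔉.N) : Aut 𝔉.BN))
    (hC5 : ∀ k : T.PiYdd, γΔ (η k) = η ⟨γ k, hγ k k.2⟩ * κ ⟨γ k, hγ k k.2⟩)
    (hκ : ∀ k : 𝔉.PiYdd, ((m.symm (κ ⟨ι k, (hι k).mp k.2⟩) : 𝔉.muTorsion 𝔉.BN 𝔉.N) : Aut 𝔉.BN) =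
      𝔉.sgpCup (𝔉.rhoYdd k) * ξ * (𝔉.sgpCup (𝔉.rhoYdd k))⁻¹ * ξ⁻¹) :
    ∀ h : 𝔉.HB,
      𝔉.psiAut Ψ β (𝔉.sgpCap (h : Aut (𝔉.base.obj 𝔉.BN)) * (𝔉.sgpCup h)⁻¹) =
        (𝔉.sgpCap (θ h) * (𝔉.sgpCup ⟨θ h, (mem_iff_of_map_equiv_eq hYdd _).mpr h.2⟩)⁻¹) *
          (𝔉.sgpCup ⟨θ h, (mem_iff_of_map_equiv_eq hYdd _).mpr h.2⟩ * ξ *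
            (𝔉.sgpCup ⟨θ h, (mem_iff_of_map_equiv_eq hYdd _).mpr h.2⟩)⁻¹ * ξ⁻¹) := by
  classical
  -- a section of `ρ : Π^tp_Ÿ̲ ↠ H_{B_N}`
  let pre : 𝔉.HB → 𝔉.PiYdd := fun h =>
    ⟨Classical.choose (Subgroup.mem_map.mp h.2), (Classical.choose_spec (Subgroup.mem_map.mp h.2)).1⟩
  have hpre : ∀ h : 𝔉.HB, 𝔉.ρ (pre h) = h := fun h => (Classical.choose_spec (Subgroup.mem_map.mp h.2)).2
  -- the `θ`-translate of a representative is represented by `ι⁻¹ γ ι`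
  have hmem : ∀ k : 𝔉.PiYdd, ι.symm (γ (ι k)) ∈ 𝔉.PiYdd := fun k =>
    (hι _).mpr (by rw [MulEquiv.apply_symm_apply]; exact hγ _ ((hι k).mp k.2))
  refine kummerComparison_of_pin (M := T.mu) Ψ β θ hYdd ξ
    (fun x => ((m.symm x : 𝔉.muTorsion 𝔉.BN 𝔉.N) : Aut 𝔉.BN))
    (fun h => η ⟨ι (pre h), (hι (pre h)).mp (pre h).2⟩) γΔ
    (sgpCap_mul_sgpCup_inv_eq_of_thetaSectionCompat_of_section H T ι m hι hpin pre hpre) hK4 ?_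
  intro h
  -- representatives: `k := pre h` of `h`, `k' := ι⁻¹ γ ι k` of `θ h`
  set k : 𝔉.PiYdd := pre h with hk
  let k' : 𝔉.PiYdd := ⟨ι.symm (γ (ι k)), hmem k⟩
  have hιk' : ι k' = γ (ι k) := MulEquiv.apply_symm_apply ι _
  have hρk' : 𝔉.ρ k' = θ h := by rw [← hpre h]; exact (hshadow k).symm
  -- (C5ét) at `ι k`, pushed through `m⁻¹`
  have step : ((m.symm (γΔ (η ⟨ι k, (hι k).mp k.2⟩)) : 𝔉.muTorsion 𝔉.BN 𝔉.N) : Aut 𝔉.BN) =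
      ((m.symm (η ⟨ι k', (hι k').mp k'.2⟩) : 𝔉.muTorsion 𝔉.BN 𝔉.N) : Aut 𝔉.BN) *
        ((m.symm (κ ⟨ι k', (hι k').mp k'.2⟩) : 𝔉.muTorsion 𝔉.BN 𝔉.N) : Aut 𝔉.BN) := by
    have ek : (⟨γ (ι k), hγ _ ((hι k).mp k.2)⟩ : T.PiYdd) = ⟨ι k', (hι k').mp k'.2⟩ := Subtype.ext hιk'.symm
    rw [hC5 ⟨ι k, (hι k).mp k.2⟩, map_mul, Subgroup.coe_mul]
    exact congrArg₂ (fun s t : T.PiYdd => ((m.symm (η s) : 𝔉.muTorsion 𝔉.BN 𝔉.N) : Aut 𝔉.BN) *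
      ((m.symm (κ t) : 𝔉.muTorsion 𝔉.BN 𝔉.N) : Aut 𝔉.BN)) ek ek
  -- the representative `pre (θ h)` chosen by the section and `k'` lie in the same `ρ`-fibre
  have hfib : η ⟨ι (pre ⟨θ h, (mem_iff_of_map_equiv_eq hYdd _).mpr h.2⟩),
        (hι _).mp (pre ⟨θ h, (mem_iff_of_map_equiv_eq hYdd _).mpr h.2⟩).2⟩ = η ⟨ι k', (hι k').mp k'.2⟩ :=
    eta_apply_eq_of_rho_eq H T ι m hι hpin (by rw [hpre, hρk'])
  -- the Kummer multiplier at `θ h`, via the representative `k'`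
  have eHB : (⟨θ h, (mem_iff_of_map_equiv_eq hYdd _).mpr h.2⟩ : 𝔉.HB) = 𝔉.rhoYdd k' := Subtype.ext hρk'.symm
  have hmult : 𝔉.sgpCup ⟨θ h, (mem_iff_of_map_equiv_eq hYdd _).mpr h.2⟩ * ξ *
        (𝔉.sgpCup ⟨θ h, (mem_iff_of_map_equiv_eq hYdd _).mpr h.2⟩)⁻¹ * ξ⁻¹ =
      ((m.symm (κ ⟨ι k', (hι k').mp k'.2⟩) : 𝔉.muTorsion 𝔉.BN 𝔉.N) : Aut 𝔉.BN) := by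
    rw [hκ k']
    exact congrArg (fun x : 𝔉.HB => 𝔉.sgpCup x * ξ * (𝔉.sgpCup x)⁻¹ * ξ⁻¹) eHB
  change ((m.symm (γΔ (η ⟨ι k, (hι k).mp k.2⟩)) : 𝔉.muTorsion 𝔉.BN 𝔉.N) : Aut 𝔉.BN) =
    ((m.symm (η ⟨ι (pre ⟨θ h, (mem_iff_of_map_equiv_eq hYdd _).mpr h.2⟩),
        (hι _).mp (pre ⟨θ h, (mem_iff_of_map_equiv_eq hYdd _).mpr h.2⟩).2⟩) : 𝔉.muTorsion 𝔉.BN 𝔉.N) : Aut 𝔉.BN) *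
      (𝔉.sgpCup ⟨θ h, (mem_iff_of_map_equiv_eq hYdd _).mpr h.2⟩ * ξ *
        (𝔉.sgpCup ⟨θ h, (mem_iff_of_map_equiv_eq hYdd _).mpr h.2⟩)⁻¹ * ξ⁻¹)
  rw [step, hfib, hmult]

end ThetaFrobenioid

end Literature.AnabelianGeometry.EtaleTheta
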